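import Summits.ValiantsHypothesis.ValiantsHypothesis.Theorems.PolyaContinuedMonotoneCoverHardCutCount
import Mathlib.LinearAlgebra.Matrix.Determinant.Basic
import Mathlib.LinearAlgebra.Matrix.Permanent
import Mathlib.Data.Complex.Basic

/-!
# Crux `MonotoneCoverHard` (stmt-ValiantsHypothesis-7421), WIDTH line: first tool for the width bet —
a Pfaffian cover has NO CENTRAL `K_{3,3}`

Helper (val-width-7421-p2 g0, 2026-08-27).  The stubs of line `few_state_cut` / `width_cut` carry the
Pfaffian hypothesis as `∃ s : Fin m × Fin m → ℂ, (∀ e, s e = 1 ∨ s e = -1) ∧ det (signed symbolic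
matrix of E) = permanent (symbolic matrix of E)`.  This file extracts from it what the width bet's
attacks need first:

* `sign_mul_prod_eq_one_of_pfaffian` — COEFFICIENT FORM: for every perfect matching `τ ⊆ E`,
  `sign τ · ∏ᵢ s (i, τ i) = 1` (compare the coefficients of the monomial `∏ X (i, τ i)` on both sides;
  exponent injectivity is val-width-7421-p1's `pexp_injective`);
* `no_central_K33_of_pfaffian` — the easy half of Little's theorem: there are no three rows `r`, three
  columns `c` with all nine edges `(r i, c j) ∈ E` and a perfect matching `μ ⊆ E` with `μ (r i) = c i`
  (a CENTRAL `K_{3,3}`): the six matchings `μ ∘ (π on the rᵢ)` would force `sign π · ∏ᵢ S_{i,π i}` to be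
  constant for the `±1` matrix `S_{ij} = s (r i, c j)`, but the three even and the three odd
  permutations of `S_3` each cover the nine cells exactly once, so the products over even and over odd
  permutations coincide — contradiction.

Why here: the WIDTH bet (`Cruxes/MonotoneCoverHard/Lines/width_cut.lean`) says label-bijective Pfaffian
covers have no wide balanced level; a wide level means parallel lanes, and lanes coupled `K_{w,w}`-style
contain central `K_{3,3}`'s.  This lemma is the kernel form of that exclusion.  VP ≠ VNP is not moved.
No definitions.
-/

namespace Summit.ValiantsHypothesis.ValiantsHypothesis.Theorems.PolyaContinuedMonotoneCoverHard

-- summit = sub-problem name (single-conjunct summit, D-0017 layout), so the namespace repeats it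
set_option linter.dupNamespace false

open scoped Classical
open Finset
open Summit.ValiantsHypothesis.ValiantsHypothesis.Theorems.PolyaContinued.MonotoneCoverHardRectangle
  (pexp_injective)

/-- Expansion of the permanent of the symbolic matrix of `E` over perfect matchings `τ ⊆ E`. -/
theorem permanent_symbolic_eq {m : ℕ} (E : Finset (Fin m × Fin m)) :
    (Matrix.of fun i j => if (i, j) ∈ E then MvPolynomial.X (i, j) else 0 :
        Matrix (Fin m) (Fin m) (MvPolynomial (Fin m × Fin m) ℂ)).permanent =
      ∑ τ : Equiv.Perm (Fin m), if (∀ i, (i, τ i) ∈ E) then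
        MvPolynomial.monomial (∑ i, Finsupp.single (i, τ i) 1) 1 else 0 := by
  rw [← Matrix.permanent_transpose]
  simp only [Matrix.permanent, Matrix.transpose_apply, Matrix.of_apply]
  refine Finset.sum_congr rfl fun τ _ => ?_
  split_ifs with h
  · rw [MvPolynomial.monomial_sum_one]
    exact Finset.prod_congr rfl fun i _ => by rw [if_pos (h i)]; rfl
  · obtain ⟨i, hi⟩ := not_forall.1 h
    exact Finset.prod_eq_zero (Finset.mem_univ i) (if_neg hi)

/-- Expansion of the determinant of the signed symbolic matrix of `E` over perfect matchings `τ ⊆ E`. -/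
theorem det_signed_symbolic_eq {m : ℕ} (E : Finset (Fin m × Fin m)) (s : Fin m × Fin m → ℂ) :
    (Matrix.of fun i j => if (i, j) ∈ E then MvPolynomial.C (s (i, j)) * MvPolynomial.X (i, j)
        else 0 : Matrix (Fin m) (Fin m) (MvPolynomial (Fin m × Fin m) ℂ)).det =
      ∑ τ : Equiv.Perm (Fin m), if (∀ i, (i, τ i) ∈ E) then
        MvPolynomial.monomial (∑ i, Finsupp.single (i, τ i) 1)
          ((Equiv.Perm.sign τ : ℂ) * ∏ i, s (i, τ i)) else 0 := by
  rw [← Matrix.det_transpose, Matrix.det_apply']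
  refine Finset.sum_congr rfl fun τ _ => ?_
  simp only [Matrix.transpose_apply, Matrix.of_apply]
  split_ifs with h
  · have hprod : (∏ i, (if (i, τ i) ∈ E then MvPolynomial.C (s (i, τ i)) * MvPolynomial.X (i, τ i)
        else 0 : MvPolynomial (Fin m × Fin m) ℂ)) =
        MvPolynomial.C (∏ i, s (i, τ i)) *
          MvPolynomial.monomial (∑ i, Finsupp.single (i, τ i) 1) 1 := by
      rw [Finset.prod_congr rfl (fun i _ => if_pos (h i)), Finset.prod_mul_distrib, ← map_prod,
        MvPolynomial.monomial_sum_one]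
      rfl
    rw [hprod, ← map_intCast (MvPolynomial.C : ℂ →+* MvPolynomial (Fin m × Fin m) ℂ), ← mul_assoc,
      ← map_mul, MvPolynomial.C_mul_monomial, mul_one]
  · obtain ⟨i, hi⟩ := not_forall.1 h
    rw [Finset.prod_eq_zero (Finset.mem_univ i) (if_neg hi), mul_zero]

/-- **Coefficient form of the Pfaffian hypothesis**: every perfect matching of `E` has
`sign τ · ∏ᵢ s (i, τ i) = 1`. -/
theorem sign_mul_prod_eq_one_of_pfaffian {m : ℕ} (E : Finset (Fin m × Fin m)) (s : Fin m × Fin m → ℂ)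
    (hdet : (Matrix.of fun i j => if (i, j) ∈ E then MvPolynomial.C (s (i, j)) * MvPolynomial.X (i, j)
        else 0 : Matrix (Fin m) (Fin m) (MvPolynomial (Fin m × Fin m) ℂ)).det =
      (Matrix.of fun i j => if (i, j) ∈ E then MvPolynomial.X (i, j) else 0 :
        Matrix (Fin m) (Fin m) (MvPolynomial (Fin m × Fin m) ℂ)).permanent)
    (τ : Equiv.Perm (Fin m)) (hτ : ∀ i, (i, τ i) ∈ E) :
    (Equiv.Perm.sign τ : ℂ) * ∏ i, s (i, τ i) = 1 := by
  rw [det_signed_symbolic_eq, permanent_symbolic_eq] at hdet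
  have h := congrArg (MvPolynomial.coeff (∑ i, Finsupp.single (i, τ i) (1 : ℕ))) hdet
  simp only [MvPolynomial.coeff_sum] at h
  rw [Finset.sum_eq_single τ, Finset.sum_eq_single τ] at h
  · simpa [if_pos hτ] using h
  · intro σ _ hσ
    split_ifs
    · rw [MvPolynomial.coeff_monomial, if_neg (fun he => hσ (pexp_injective he))]
    · simp
  · simp
  · intro σ _ hσ
    split_ifs
    · rw [MvPolynomial.coeff_monomial, if_neg (fun he => hσ (pexp_injective he))]
    · simp
  · simp

/-- **A Pfaffian cover has no central `K_{3,3}`** (the easy half of Little's theorem, in the cover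
formalism): if `det (signed symbolic matrix of E) = permanent (symbolic matrix of E)` for a `±1` signing
`s`, there are no three distinct rows `r i` and columns `c j` with all nine edges `(r i, c j) ∈ E`
together with a perfect matching `μ ⊆ E` matching `r i` to `c i` (so that the other six matchings of
the `K_{3,3}` also extend to perfect matchings of `E`). -/
theorem no_central_K33_of_pfaffian {m : ℕ} (E : Finset (Fin m × Fin m)) (s : Fin m × Fin m → ℂ)
    (hs : ∀ e, s e = 1 ∨ s e = -1)
    (hdet : (Matrix.of fun i j => if (i, j) ∈ E then MvPolynomial.C (s (i, j)) * MvPolynomial.X (i, j)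
        else 0 : Matrix (Fin m) (Fin m) (MvPolynomial (Fin m × Fin m) ℂ)).det =
      (Matrix.of fun i j => if (i, j) ∈ E then MvPolynomial.X (i, j) else 0 :
        Matrix (Fin m) (Fin m) (MvPolynomial (Fin m × Fin m) ℂ)).permanent)
    (r c : Fin 3 → Fin m) (hr : Function.Injective r) (hE : ∀ i j, (r i, c j) ∈ E)
    (μ : Equiv.Perm (Fin m)) (hμ : ∀ x, (x, μ x) ∈ E) (hμr : ∀ i, μ (r i) = c i) : False := by
  set f := Equiv.ofInjective r hr with hf
  -- for every `π ∈ S_3`, the matching `μ ∘ (π on the rows r)` is a perfect matching of `E`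
  have key : ∀ π : Equiv.Perm (Fin 3),
      (Equiv.Perm.sign π : ℂ) * ∏ i, s (r i, c (π i)) = ∏ i, s (r i, c i) := by
    intro π
    set ρ : Equiv.Perm (Fin m) := π.extendDomain f with hρ
    have hρr : ∀ i, ρ (r i) = r (π i) := by
      intro i
      have := Equiv.Perm.extendDomain_apply_image π f i
      simpa [hf] using this
    have hρo : ∀ x, x ∉ Set.range r → ρ x = x := fun x hx =>
      Equiv.Perm.extendDomain_apply_not_subtype π f hx
    set τ : Equiv.Perm (Fin m) := μ * ρ with hτ
    have hτr : ∀ i, τ (r i) = c (π i) := by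
      intro i; simp only [hτ, Equiv.Perm.mul_apply, hρr, hμr]
    have hτo : ∀ x, x ∉ Set.range r → τ x = μ x := by
      intro x hx; simp only [hτ, Equiv.Perm.mul_apply, hρo x hx]
    have hτE : ∀ x, (x, τ x) ∈ E := by
      intro x
      by_cases hx : x ∈ Set.range r
      · obtain ⟨i, rfl⟩ := hx
        rw [hτr]; exact hE i (π i)
      · rw [hτo x hx]; exact hμ x
    have e1 := sign_mul_prod_eq_one_of_pfaffian E s hdet τ hτE
    have e2 := sign_mul_prod_eq_one_of_pfaffian E s hdet μ hμ
    have hsign : (Equiv.Perm.sign τ : ℂ) = (Equiv.Perm.sign μ : ℂ) * (Equiv.Perm.sign π : ℂ) := by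
      simp only [hτ, Equiv.Perm.sign_mul, hρ, Equiv.Perm.sign_extendDomain, Units.val_mul,
        Int.cast_mul]
    -- split the products over the rows `r i` and the rest
    have himg : ∀ σ : Equiv.Perm (Fin m), ∏ x ∈ Finset.univ.image r, s (x, σ x) =
        ∏ i, s (r i, σ (r i)) := fun σ => Finset.prod_image fun i _ j _ h => hr h
    have hsplit : ∀ σ : Equiv.Perm (Fin m), ∏ x, s (x, σ x) =
        (∏ x ∈ Finset.univ.image r, s (x, σ x)) * ∏ x ∈ (Finset.univ.image r)ᶜ, s (x, σ x) :=
      fun σ => (Finset.prod_mul_prod_compl _ _).symm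
    have hrest : ∏ x ∈ (Finset.univ.image r)ᶜ, s (x, τ x) =
        ∏ x ∈ (Finset.univ.image r)ᶜ, s (x, μ x) := by
      refine Finset.prod_congr rfl fun x hx => ?_
      rw [hτo x]
      intro hx'
      obtain ⟨i, rfl⟩ := hx'
      exact (Finset.mem_compl.1 hx) (Finset.mem_image_of_mem _ (Finset.mem_univ i))
    rw [hsign, hsplit τ, himg τ, hrest] at e1
    rw [hsplit μ, himg μ] at e2
    simp only [hτr, hμr] at e1 e2
    -- cancel the common unit `sign μ · (rest)`
    set D := ∏ x ∈ (Finset.univ.image r)ᶜ, s (x, μ x) with hD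
    have hu : (Equiv.Perm.sign μ : ℂ) * D ≠ 0 := by
      intro h0
      have : (Equiv.Perm.sign μ : ℂ) * ((∏ i, s (r i, c i)) * D) = 0 := by
        calc (Equiv.Perm.sign μ : ℂ) * ((∏ i, s (r i, c i)) * D)
            = ((Equiv.Perm.sign μ : ℂ) * D) * ∏ i, s (r i, c i) := by ring
          _ = 0 := by rw [h0, zero_mul]
      rw [this] at e2
      exact zero_ne_one e2
    apply mul_left_cancel₀ hu
    calc (Equiv.Perm.sign μ : ℂ) * D * ((Equiv.Perm.sign π : ℂ) * ∏ i, s (r i, c (π i)))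
        = (Equiv.Perm.sign μ : ℂ) * (Equiv.Perm.sign π : ℂ) * ((∏ i, s (r i, c (π i))) * D) := by
          ring
      _ = 1 := e1
      _ = (Equiv.Perm.sign μ : ℂ) * ((∏ i, s (r i, c i)) * D) := e2.symm
      _ = (Equiv.Perm.sign μ : ℂ) * D * ∏ i, s (r i, c i) := by ring
  -- the three transpositions and the two 3-cycles
  have k01 := key (Equiv.swap 0 1)
  have k02 := key (Equiv.swap 0 2)
  have k12 := key (Equiv.swap 1 2)
  have kc := key (Equiv.swap 0 1 * Equiv.swap 1 2)
  have kcc := key (Equiv.swap 1 2 * Equiv.swap 0 1)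
  simp only [Fin.prod_univ_three, Equiv.Perm.sign_swap (show (0 : Fin 3) ≠ 1 by decide),
    Equiv.Perm.sign_swap (show (0 : Fin 3) ≠ 2 by decide),
    Equiv.Perm.sign_swap (show (1 : Fin 3) ≠ 2 by decide), Equiv.Perm.sign_mul,
    Units.val_neg, Units.val_one, Int.cast_neg, Int.cast_one, Equiv.Perm.mul_apply,
    show Equiv.swap (0 : Fin 3) 1 0 = 1 by decide, show Equiv.swap (0 : Fin 3) 1 1 = 0 by decide,
    show Equiv.swap (0 : Fin 3) 1 2 = 2 by decide, show Equiv.swap (0 : Fin 3) 2 0 = 2 by decide,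
    show Equiv.swap (0 : Fin 3) 2 1 = 1 by decide, show Equiv.swap (0 : Fin 3) 2 2 = 0 by decide,
    show Equiv.swap (1 : Fin 3) 2 0 = 0 by decide, show Equiv.swap (1 : Fin 3) 2 1 = 2 by decide,
    show Equiv.swap (1 : Fin 3) 2 2 = 1 by decide, neg_mul, one_mul, mul_neg, mul_one, neg_neg]
    at k01 k02 k12 kc kcc
  -- `A_1 · A_c · A_c² = A_(01) · A_(02) · A_(12)` (both are the product of all nine signs)
  set A := s (r 0, c 0) * s (r 1, c 1) * s (r 2, c 2) with hA
  have hA0 : A ≠ 0 := by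
    have hnz : ∀ e, s e ≠ 0 := fun e => by
      rcases hs e with h | h <;> rw [h] <;> norm_num
    simp only [hA]
    exact mul_ne_zero (mul_ne_zero (hnz _) (hnz _)) (hnz _)
  have hcube : A * A * A = -(A * A * A) := by
    calc A * A * A
        = (s (r 0, c 1) * s (r 1, c 2) * s (r 2, c 0)) * (s (r 0, c 2) * s (r 1, c 0) * s (r 2, c 1)) *
            (s (r 0, c 0) * s (r 1, c 1) * s (r 2, c 2)) := by rw [kc, kcc]
      _ = -((-(s (r 0, c 1) * s (r 1, c 0) * s (r 2, c 2))) *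
            (-(s (r 0, c 2) * s (r 1, c 1) * s (r 2, c 0))) *
            (-(s (r 0, c 0) * s (r 1, c 2) * s (r 2, c 1)))) := by ring
      _ = -(A * A * A) := by rw [k01, k02, k12]
  have h3 : A * A * A = 0 := by
    have := hcube
    linear_combination (1 / 2 : ℂ) * this
  have hA : A = 0 := by
    rcases mul_eq_zero.1 h3 with h | h
    · rcases mul_eq_zero.1 h with h' | h' <;> exact h'
    · exact h
  exact hA0 hA

end Summit.ValiantsHypothesis.ValiantsHypothesis.Theorems.PolyaContinuedMonotoneCoverHard
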